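import Summits.QuantumFields.BalabanUV.Beta.GAN24.StencilSlotE3Tables

/-!
# `BalabanUV.Beta.GAN24.StencilSlotRowsMerge` — binder row G-an2-4 / (CONV-C), S-slot, road «S3»: THE TWELVE ROWS AT INDEPENDENT
# PER-ROW SCALARS ⟹ the wall's `(hS, hSall)`; THE SEVEN SHAPE ROWS ALONE ⟹ `hS`
# (carver socket «ROWS-MERGE», couriered by the row owner b2b-balaban-gan24-p1, gen 4)

NOT IN PRINT; OUR PROOF ATTEMPT.  HONEST FRAMING (cell contract, verbatim): «discharging `BetaPertH` makes Bałaban's UV stability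
UNCONDITIONAL — a real constructive-QFT result; it is NOT the continuum limit and NOT the Clay problem.»  HONEST DEPENDENCY (verbatim):
«continuum YM on T⁴ ⇐ BetaPertH ∧ nine spine estimates (0/9 proved); BetaPertH ⇐ (D1) ∧ (D4) ∧ CAP+tail; G-an2-4 gates asym, D1 and
NE2/3/4.»  [folklore] bookkeeping only.

AUTHORSHIP.  §1–§2 are the FORMAL-swarm CARVER's probe «ROWS-MERGE» v1 (b2b-balaban-gan24-formalise-carver gen 8, records
`HOME/b2b-balaban-gan24-formalise-carver/Formal/probe/RowsMergeProbe.v1-full.lean` a87d45d74d511c4a, journal l.4876 ∕ l.5295), couriered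
VERBATIM up to the namespace and one inlined one-liner (planners do not file under `Summits/…/Theorems`); §3 is the row owner's addition.

WHY.  The row owner's third END `StencilSlotE3Tables.hS_hSall_of_rows` takes the twelve analytic rows of road «S3» (seven SHAPE rows
`hW hV0 hL0 hVt hLt hV hL`, five depth-paired DIFFERENCE rows `dW dVt dLt dV dL`) at COMMON scalars `{δ θ ρ}` (`0 < δ`, `0 < θ < 1`,
`0 ≤ ρ < 1`).  The rows are landed by up to twelve different seats, each at ITS OWN rate `δᵢ` and ratios `θᵢ`, `ρᵢ` (existentially
packaged).  This module is the socket between the two.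

* §1 `rows_merge` (generic `d`, ABSTRACT in the twelve families): twelve rows each at its own scalars ⟹ the twelve rows at ONE common
  `(δ, θ, ρ)` — `δ := min` of the seven SHAPE rates, `θ := max` of the nine ratios and `1/2`, `ρ := max` of the two depth ratios, geometric
  constants replaced by `max c 0`; every row is only WEAKENED (`StencilSlotOfShapes.locStencil_mono'`, `pow_le_pow_left₀`).
  `shapeRows_merge`: the same for the seven SHAPE rows alone (`0 ≤ θ < 1` suffices for `StencilSlotE3OfPieces.e3Shape_of_pieces`).
* §2 (`d = 3`, `2 ≤ Lc`) `hS_hSall_of_rows_indep`: the LITERAL conclusion of `hS_hSall_of_rows` from the twelve rows each ∃-packaged at its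
  own scalars (row texts verbatim from the END).  (The carver's (C17) `d1Drift_JsBalOf_iff_of_rows_indep` — the D1 wall ⟺ the identification
  from the same rows and an2's W-rows via `StencilSlotWallPlug` — stays in the carver's records twin; it is one `obtain` away from §2.)
* §3 (`d = 3`, `2 ≤ Lc`) `hS_of_shapeRows_indep`: the wall's NON-CAUCHY S-row `hS` from the SEVEN SHAPE rows ALONE (each at its own
  scalars), via `shapeRows_merge` ∘ `StencilSlotE3OfPieces.e3Shape_of_pieces` ∘ `StencilSlotOfE3.hS_of_e3` — `hS` can close before `hSall`.

HONEST: composition only; discharges NONE of the twelve rows; (hS, hSall) NOT discharged here; NOT «S-slot closed», NOT «G-an2-4 closed»;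
NOT BetaPertH, NOT continuum, NOT Clay.
-/

noncomputable section

open Literature.MathematicalPhysics.QuantumFieldTheory
open Literature.MathematicalPhysics.QuantumFieldTheory.Balaban1983to89
open Literature.MathematicalPhysics.QuantumFieldTheory.Balaban1983to89.Beta
open ExpKernelCalculus (MKer BiLoc VertexFamily₂)
open OneStepResolventKernel (Fib LocStencil KInv)
open StepJetData (wilsonA mfNeg)
open AveragingHessianKernels (vhS hessFF)
open InterLevelTransport (SLam)
open BalabanStepJets (lamCoeffOf)
open BalabanCompositeJets (pushSum borderInc lagrInc)
open BalabanStepJetsSucc (wE e3Of JsBal0Of)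
open Summit.QuantumFields.BalabanUV.Beta.HessKerDressedUnits (unitS)
open Summit.QuantumFields.BalabanUV.Beta.GAN24.CombesThomas (SupBound sfStep smStep)
open Summit.QuantumFields.BalabanUV.Beta.GAN24.E3UnitSplit (e3OfS)
open Summit.QuantumFields.BalabanUV.Beta.GAN24.StencilSlotOfShapes (locStencil_mono')
open Summit.QuantumFields.BalabanUV.Beta.GAN24.StencilSlotOfE3 (one_le_of_two_le hS_of_e3)
open Summit.QuantumFields.BalabanUV.Beta.GAN24.StencilSlotE3OfPieces (e3Shape_of_pieces)
open Summit.QuantumFields.BalabanUV.Beta.GAN24.StencilSlotE3Tables (hS_hSall_of_rows)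

namespace Summit.QuantumFields.BalabanUV.Beta.GAN24.StencilSlotRowsMerge

section Merge

variable {d : ℕ}

/-! ## §1a Monotone bumps of geometric constants (carver) -/

/-- [folklore] `c·θ^k ≤ (max c 0)·θ'^k` for `0 ≤ θ ≤ θ'`. -/
theorem geom_le_max_geom {c θ θ' : ℝ} (k : ℕ) (hθ0 : 0 ≤ θ) (hθ : θ ≤ θ') :
    c * θ ^ k ≤ max c 0 * θ' ^ k :=
  (mul_le_mul_of_nonneg_right (le_max_left c 0) (pow_nonneg hθ0 k)).trans
    (mul_le_mul_of_nonneg_left (pow_le_pow_left₀ hθ0 hθ k) (le_max_right c 0))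

/-- [folklore] Two-ratio version: `e·θ^k·ρ^j ≤ (max e 0)·θ'^k·ρ'^j` for `0 ≤ θ ≤ θ'`, `0 ≤ ρ ≤ ρ'`. -/
theorem geom₂_le_max_geom₂ {e θ θ' ρ ρ' : ℝ} (k j : ℕ) (hθ0 : 0 ≤ θ) (hθ : θ ≤ θ') (hρ0 : 0 ≤ ρ) (hρ : ρ ≤ ρ') :
    e * θ ^ k * ρ ^ j ≤ max e 0 * θ' ^ k * ρ' ^ j :=
  (mul_le_mul_of_nonneg_right (geom_le_max_geom k hθ0 hθ) (pow_nonneg hρ0 j)).trans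
    (mul_le_mul_of_nonneg_left (pow_le_pow_left₀ hρ0 hρ j)
      (mul_nonneg (le_max_right e 0) (pow_nonneg (hθ0.trans hθ) k)))

/-- [folklore] A `LocStencil` row with a geometric constant `c·θ^k` is a row with constant `(max c 0)·θ'^k` at any larger ratio and smaller rate. -/
theorem locStencil_geom_mono {S : Fin (d + 1) → (Fin (d + 1) → ℤ) → MKer (d + 1) (Fib d)} {c θ θ' δ δ' : ℝ} {k : ℕ}
    (h : LocStencil S (c * θ ^ k) δ) (hθ0 : 0 ≤ θ) (hθ : θ ≤ θ') (hδ : δ' ≤ δ) :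
    LocStencil S (max c 0 * θ' ^ k) δ' :=
  locStencil_mono' h (geom_le_max_geom k hθ0 hθ) hδ

/-- [folklore] A `SupBound` row with a geometric bound `e·θ^k` is a row with bound `(max e 0)·θ'^k` at any larger ratio. -/
theorem supBound_geom_mono {D : ℕ} {F : Type*} {A : MKer D F} {e θ θ' : ℝ} {k : ℕ}
    (h : SupBound A (e * θ ^ k)) (hθ0 : 0 ≤ θ) (hθ : θ ≤ θ') : SupBound A (max e 0 * θ' ^ k) :=
  fun x y a b => (h x y a b).trans (geom_le_max_geom k hθ0 hθ)

/-- [folklore] Two-ratio version of `supBound_geom_mono`. -/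
theorem supBound_geom₂_mono {D : ℕ} {F : Type*} {A : MKer D F} {e θ θ' ρ ρ' : ℝ} {k j : ℕ}
    (h : SupBound A (e * θ ^ k * ρ ^ j)) (hθ0 : 0 ≤ θ) (hθ : θ ≤ θ') (hρ0 : 0 ≤ ρ) (hρ : ρ ≤ ρ') :
    SupBound A (max e 0 * θ' ^ k * ρ' ^ j) :=
  fun x y a b => (h x y a b).trans (geom₂_le_max_geom₂ k j hθ0 hθ hρ0 hρ)

/-! ## §1b THE MERGE: twelve rows with independent scalars ⟹ twelve rows with common `(δ, θ, ρ)` (carver) -/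

/-- **ROWS-MERGE** [folklore]: the seven SHAPE rows and five DIFFERENCE rows of road «S3», each GIVEN AT ITS OWN rate∕ratios (existentially
packaged, as independent seats will land them), hold at ONE common rate `δ > 0`, ONE common member ratio `θ ∈ (0,1)` and ONE common depth ratio
`ρ ∈ [0,1)` — exactly the scalar discipline of `StencilSlotE3Tables.e3Shape_and_supRate_of_rows` ∕ `hS_hSall_of_rows`.  Abstract in the
twelve families; no property of the tables is used. -/
theorem rows_merge
    {SW SV0 SL0 SVt SLt : ℕ → Fin (d + 1) → (Fin (d + 1) → ℤ) → MKer (d + 1) (Fib d)}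
    {SV SL : ℕ → ℕ → Fin (d + 1) → (Fin (d + 1) → ℤ) → MKer (d + 1) (Fib d)}
    {DW DVt DLt : ℕ → Fin (d + 1) → (Fin (d + 1) → ℤ) → MKer (d + 1) (Fib d)}
    {DV DL : ℕ → ℕ → Fin (d + 1) → (Fin (d + 1) → ℤ) → MKer (d + 1) (Fib d)}
    (hW : ∃ C δ : ℝ, 0 < δ ∧ ∀ n, LocStencil (SW n) C δ)
    (hV0 : ∃ c θ δ : ℝ, 0 < δ ∧ 0 ≤ θ ∧ θ < 1 ∧ ∀ n, LocStencil (SV0 n) (c * θ ^ (n + 1)) δ)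
    (hL0 : ∃ c θ δ : ℝ, 0 < δ ∧ 0 ≤ θ ∧ θ < 1 ∧ ∀ n, LocStencil (SL0 n) (c * θ ^ (n + 1)) δ)
    (hVt : ∃ C δ : ℝ, 0 < δ ∧ ∀ n, LocStencil (SVt n) C δ)
    (hLt : ∃ C δ : ℝ, 0 < δ ∧ ∀ n, LocStencil (SLt n) C δ)
    (hV : ∃ c θ δ : ℝ, 0 < δ ∧ 0 ≤ θ ∧ θ < 1 ∧ ∀ n m, m < n → LocStencil (SV n m) (c * θ ^ (n - m)) δ)
    (hL : ∃ c θ δ : ℝ, 0 < δ ∧ 0 ≤ θ ∧ θ < 1 ∧ ∀ n m, m < n → LocStencil (SL n m) (c * θ ^ (n - m)) δ)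
    (dW : ∃ e θ : ℝ, 0 ≤ θ ∧ θ < 1 ∧ ∀ n κ' u', SupBound (DW n κ' u') (e * θ ^ (n + 1)))
    (dVt : ∃ e θ : ℝ, 0 ≤ θ ∧ θ < 1 ∧ ∀ n κ' u', SupBound (DVt n κ' u') (e * θ ^ (n + 1)))
    (dLt : ∃ e θ : ℝ, 0 ≤ θ ∧ θ < 1 ∧ ∀ n κ' u', SupBound (DLt n κ' u') (e * θ ^ (n + 1)))
    (dV : ∃ e θ ρ : ℝ, 0 ≤ θ ∧ θ < 1 ∧ 0 ≤ ρ ∧ ρ < 1 ∧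
      ∀ n m, m < n → ∀ κ' u', SupBound (DV n m κ' u') (e * θ ^ (n + 1) * ρ ^ (n - m)))
    (dL : ∃ e θ ρ : ℝ, 0 ≤ θ ∧ θ < 1 ∧ 0 ≤ ρ ∧ ρ < 1 ∧
      ∀ n m, m < n → ∀ κ' u', SupBound (DL n m κ' u') (e * θ ^ (n + 1) * ρ ^ (n - m))) :
    ∃ δ θ ρ CW c₀V c₀L CtV CtL cV cL eW eVt eLt eV eL : ℝ,
      0 < δ ∧ 0 < θ ∧ θ < 1 ∧ 0 ≤ ρ ∧ ρ < 1 ∧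
      (∀ n, LocStencil (SW n) CW δ) ∧
      (∀ n, LocStencil (SV0 n) (c₀V * θ ^ (n + 1)) δ) ∧
      (∀ n, LocStencil (SL0 n) (c₀L * θ ^ (n + 1)) δ) ∧
      (∀ n, LocStencil (SVt n) CtV δ) ∧
      (∀ n, LocStencil (SLt n) CtL δ) ∧
      (∀ n m, m < n → LocStencil (SV n m) (cV * θ ^ (n - m)) δ) ∧
      (∀ n m, m < n → LocStencil (SL n m) (cL * θ ^ (n - m)) δ) ∧
      (∀ n κ' u', SupBound (DW n κ' u') (eW * θ ^ (n + 1))) ∧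
      (∀ n κ' u', SupBound (DVt n κ' u') (eVt * θ ^ (n + 1))) ∧
      (∀ n κ' u', SupBound (DLt n κ' u') (eLt * θ ^ (n + 1))) ∧
      (∀ n m, m < n → ∀ κ' u', SupBound (DV n m κ' u') (eV * θ ^ (n + 1) * ρ ^ (n - m))) ∧
      (∀ n m, m < n → ∀ κ' u', SupBound (DL n m κ' u') (eL * θ ^ (n + 1) * ρ ^ (n - m))) := by
  obtain ⟨CW, δ₁, hδ₁, hW⟩ := hW
  obtain ⟨c₂, θ₂, δ₂, hδ₂, hθ₂0, hθ₂1, hV0⟩ := hV0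
  obtain ⟨c₃, θ₃, δ₃, hδ₃, hθ₃0, hθ₃1, hL0⟩ := hL0
  obtain ⟨CtV, δ₄, hδ₄, hVt⟩ := hVt
  obtain ⟨CtL, δ₅, hδ₅, hLt⟩ := hLt
  obtain ⟨c₆, θ₆, δ₆, hδ₆, hθ₆0, hθ₆1, hV⟩ := hV
  obtain ⟨c₇, θ₇, δ₇, hδ₇, hθ₇0, hθ₇1, hL⟩ := hL
  obtain ⟨e₈, θ₈, hθ₈0, hθ₈1, dW⟩ := dW
  obtain ⟨e₉, θ₉, hθ₉0, hθ₉1, dVt⟩ := dVt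
  obtain ⟨e₁₀, θ₁₀, hθ₁₀0, hθ₁₀1, dLt⟩ := dLt
  obtain ⟨e₁₁, θ₁₁, ρ₁₁, hθ₁₁0, hθ₁₁1, hρ₁₁0, hρ₁₁1, dV⟩ := dV
  obtain ⟨e₁₂, θ₁₂, ρ₁₂, hθ₁₂0, hθ₁₂1, hρ₁₂0, hρ₁₂1, dL⟩ := dL
  -- common scalars
  set δ : ℝ := min δ₁ (min δ₂ (min δ₃ (min δ₄ (min δ₅ (min δ₆ δ₇))))) with hδdef
  set θ : ℝ := max (max (max (max (max (max (max (max (max (1 / 2) θ₂) θ₃) θ₆) θ₇) θ₈) θ₉) θ₁₀) θ₁₁) θ₁₂ with hθdef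
  set ρ : ℝ := max ρ₁₁ ρ₁₂ with hρdef
  have hδ : 0 < δ := lt_min hδ₁ (lt_min hδ₂ (lt_min hδ₃ (lt_min hδ₄ (lt_min hδ₅ (lt_min hδ₆ hδ₇)))))
  have hθ0 : 0 < θ := by
    have : (1 / 2 : ℝ) ≤ θ := by simp only [hθdef, le_max_iff, le_refl, true_or]
    linarith
  have hθ1 : θ < 1 := by
    simp only [hθdef, max_lt_iff]
    exact ⟨⟨⟨⟨⟨⟨⟨⟨⟨by norm_num, hθ₂1⟩, hθ₃1⟩, hθ₆1⟩, hθ₇1⟩, hθ₈1⟩, hθ₉1⟩, hθ₁₀1⟩, hθ₁₁1⟩, hθ₁₂1⟩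
  have hρ0 : 0 ≤ ρ := hρ₁₁0.trans (le_max_left _ _)
  have hρ1 : ρ < 1 := max_lt hρ₁₁1 hρ₁₂1
  -- the individual comparisons
  have l₁ : δ ≤ δ₁ := by simp only [hδdef, min_le_iff, le_refl, true_or]
  have l₂ : δ ≤ δ₂ := by simp only [hδdef, min_le_iff, le_refl, true_or, or_true]
  have l₃ : δ ≤ δ₃ := by simp only [hδdef, min_le_iff, le_refl, true_or, or_true]
  have l₄ : δ ≤ δ₄ := by simp only [hδdef, min_le_iff, le_refl, true_or, or_true]
  have l₅ : δ ≤ δ₅ := by simp only [hδdef, min_le_iff, le_refl, true_or, or_true]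
  have l₆ : δ ≤ δ₆ := by simp only [hδdef, min_le_iff, le_refl, true_or, or_true]
  have l₇ : δ ≤ δ₇ := by simp only [hδdef, min_le_iff, le_refl, or_true]
  have t₂ : θ₂ ≤ θ := by simp only [hθdef, le_max_iff, le_refl, true_or, or_true]
  have t₃ : θ₃ ≤ θ := by simp only [hθdef, le_max_iff, le_refl, true_or, or_true]
  have t₆ : θ₆ ≤ θ := by simp only [hθdef, le_max_iff, le_refl, true_or, or_true]
  have t₇ : θ₇ ≤ θ := by simp only [hθdef, le_max_iff, le_refl, true_or, or_true]
  have t₈ : θ₈ ≤ θ := by simp only [hθdef, le_max_iff, le_refl, true_or, or_true]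
  have t₉ : θ₉ ≤ θ := by simp only [hθdef, le_max_iff, le_refl, true_or, or_true]
  have t₁₀ : θ₁₀ ≤ θ := by simp only [hθdef, le_max_iff, le_refl, true_or, or_true]
  have t₁₁ : θ₁₁ ≤ θ := by simp only [hθdef, le_max_iff, le_refl, true_or, or_true]
  have t₁₂ : θ₁₂ ≤ θ := by simp only [hθdef, le_max_iff, le_refl, or_true]
  have r₁₁ : ρ₁₁ ≤ ρ := le_max_left _ _
  have r₁₂ : ρ₁₂ ≤ ρ := le_max_right _ _
  refine ⟨δ, θ, ρ, CW, max c₂ 0, max c₃ 0, CtV, CtL, max c₆ 0, max c₇ 0, max e₈ 0, max e₉ 0, max e₁₀ 0, max e₁₁ 0, max e₁₂ 0,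
    hδ, hθ0, hθ1, hρ0, hρ1, ?_, ?_, ?_, ?_, ?_, ?_, ?_, ?_, ?_, ?_, ?_, ?_⟩
  · exact fun n => locStencil_mono' (hW n) le_rfl l₁
  · exact fun n => locStencil_geom_mono (hV0 n) hθ₂0 t₂ l₂
  · exact fun n => locStencil_geom_mono (hL0 n) hθ₃0 t₃ l₃
  · exact fun n => locStencil_mono' (hVt n) le_rfl l₄
  · exact fun n => locStencil_mono' (hLt n) le_rfl l₅
  · exact fun n m hm => locStencil_geom_mono (hV n m hm) hθ₆0 t₆ l₆
  · exact fun n m hm => locStencil_geom_mono (hL n m hm) hθ₇0 t₇ l₇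
  · exact fun n κ' u' => supBound_geom_mono (dW n κ' u') hθ₈0 t₈
  · exact fun n κ' u' => supBound_geom_mono (dVt n κ' u') hθ₉0 t₉
  · exact fun n κ' u' => supBound_geom_mono (dLt n κ' u') hθ₁₀0 t₁₀
  · exact fun n m hm κ' u' => supBound_geom₂_mono (dV n m hm κ' u') hθ₁₁0 t₁₁ hρ₁₁0 r₁₁
  · exact fun n m hm κ' u' => supBound_geom₂_mono (dL n m hm κ' u') hθ₁₂0 t₁₂ hρ₁₂0 r₁₂

/-! ## §1c The seven SHAPE rows alone (row owner) -/

/-- **SHAPE-ROWS-MERGE** [folklore]: the seven SHAPE rows of road «S3», each given at its own rate∕ratio, hold at ONE common rate `δ > 0` and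
ONE common ratio `θ ∈ [0,1)` — the scalar discipline of `StencilSlotE3OfPieces.e3Shape_of_pieces`.  Abstract in the seven families. -/
theorem shapeRows_merge
    {SW SV0 SL0 SVt SLt : ℕ → Fin (d + 1) → (Fin (d + 1) → ℤ) → MKer (d + 1) (Fib d)}
    {SV SL : ℕ → ℕ → Fin (d + 1) → (Fin (d + 1) → ℤ) → MKer (d + 1) (Fib d)}
    (hW : ∃ C δ : ℝ, 0 < δ ∧ ∀ n, LocStencil (SW n) C δ)
    (hV0 : ∃ c θ δ : ℝ, 0 < δ ∧ 0 ≤ θ ∧ θ < 1 ∧ ∀ n, LocStencil (SV0 n) (c * θ ^ (n + 1)) δ)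
    (hL0 : ∃ c θ δ : ℝ, 0 < δ ∧ 0 ≤ θ ∧ θ < 1 ∧ ∀ n, LocStencil (SL0 n) (c * θ ^ (n + 1)) δ)
    (hVt : ∃ C δ : ℝ, 0 < δ ∧ ∀ n, LocStencil (SVt n) C δ)
    (hLt : ∃ C δ : ℝ, 0 < δ ∧ ∀ n, LocStencil (SLt n) C δ)
    (hV : ∃ c θ δ : ℝ, 0 < δ ∧ 0 ≤ θ ∧ θ < 1 ∧ ∀ n m, m < n → LocStencil (SV n m) (c * θ ^ (n - m)) δ)
    (hL : ∃ c θ δ : ℝ, 0 < δ ∧ 0 ≤ θ ∧ θ < 1 ∧ ∀ n m, m < n → LocStencil (SL n m) (c * θ ^ (n - m)) δ) :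
    ∃ δ θ CW c₀V c₀L CtV CtL cV cL : ℝ, 0 < δ ∧ 0 ≤ θ ∧ θ < 1 ∧
      (∀ n, LocStencil (SW n) CW δ) ∧
      (∀ n, LocStencil (SV0 n) (c₀V * θ ^ (n + 1)) δ) ∧
      (∀ n, LocStencil (SL0 n) (c₀L * θ ^ (n + 1)) δ) ∧
      (∀ n, LocStencil (SVt n) CtV δ) ∧
      (∀ n, LocStencil (SLt n) CtL δ) ∧
      (∀ n m, m < n → LocStencil (SV n m) (cV * θ ^ (n - m)) δ) ∧
      (∀ n m, m < n → LocStencil (SL n m) (cL * θ ^ (n - m)) δ) := by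
  obtain ⟨CW, δ₁, hδ₁, hW⟩ := hW
  obtain ⟨c₂, θ₂, δ₂, hδ₂, hθ₂0, hθ₂1, hV0⟩ := hV0
  obtain ⟨c₃, θ₃, δ₃, hδ₃, hθ₃0, hθ₃1, hL0⟩ := hL0
  obtain ⟨CtV, δ₄, hδ₄, hVt⟩ := hVt
  obtain ⟨CtL, δ₅, hδ₅, hLt⟩ := hLt
  obtain ⟨c₆, θ₆, δ₆, hδ₆, hθ₆0, hθ₆1, hV⟩ := hV
  obtain ⟨c₇, θ₇, δ₇, hδ₇, hθ₇0, hθ₇1, hL⟩ := hL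
  set δ : ℝ := min δ₁ (min δ₂ (min δ₃ (min δ₄ (min δ₅ (min δ₆ δ₇))))) with hδdef
  set θ : ℝ := max (max (max θ₂ θ₃) θ₆) θ₇ with hθdef
  have hδ : 0 < δ := lt_min hδ₁ (lt_min hδ₂ (lt_min hδ₃ (lt_min hδ₄ (lt_min hδ₅ (lt_min hδ₆ hδ₇)))))
  have t₂ : θ₂ ≤ θ := ((le_max_left _ _).trans (le_max_left _ _)).trans (le_max_left _ _)
  have t₃ : θ₃ ≤ θ := ((le_max_right _ _).trans (le_max_left _ _)).trans (le_max_left _ _)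
  have t₆ : θ₆ ≤ θ := (le_max_right _ _).trans (le_max_left _ _)
  have t₇ : θ₇ ≤ θ := le_max_right _ _
  have hθ0 : 0 ≤ θ := hθ₂0.trans t₂
  have hθ1 : θ < 1 := max_lt (max_lt (max_lt hθ₂1 hθ₃1) hθ₆1) hθ₇1
  have l₁ : δ ≤ δ₁ := by simp only [hδdef, min_le_iff, le_refl, true_or]
  have l₂ : δ ≤ δ₂ := by simp only [hδdef, min_le_iff, le_refl, true_or, or_true]
  have l₃ : δ ≤ δ₃ := by simp only [hδdef, min_le_iff, le_refl, true_or, or_true]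
  have l₄ : δ ≤ δ₄ := by simp only [hδdef, min_le_iff, le_refl, true_or, or_true]
  have l₅ : δ ≤ δ₅ := by simp only [hδdef, min_le_iff, le_refl, true_or, or_true]
  have l₆ : δ ≤ δ₆ := by simp only [hδdef, min_le_iff, le_refl, true_or, or_true]
  have l₇ : δ ≤ δ₇ := by simp only [hδdef, min_le_iff, le_refl, or_true]
  refine ⟨δ, θ, CW, max c₂ 0, max c₃ 0, CtV, CtL, max c₆ 0, max c₇ 0, hδ, hθ0, hθ1, ?_, ?_, ?_, ?_, ?_, ?_, ?_⟩
  · exact fun n => locStencil_mono' (hW n) le_rfl l₁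
  · exact fun n => locStencil_geom_mono (hV0 n) hθ₂0 t₂ l₂
  · exact fun n => locStencil_geom_mono (hL0 n) hθ₃0 t₃ l₃
  · exact fun n => locStencil_mono' (hVt n) le_rfl l₄
  · exact fun n => locStencil_mono' (hLt n) le_rfl l₅
  · exact fun n m hm => locStencil_geom_mono (hV n m hm) hθ₆0 t₆ l₆
  · exact fun n m hm => locStencil_geom_mono (hL n m hm) hθ₇0 t₇ l₇

end Merge

section Three

variable {Lc : ℕ} [NeZero Lc]

/-! ## §2 The owner's third END at independent per-row scalars (`d = 3`, `2 ≤ Lc`; carver (C16)) -/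

/-- (carver C16) **THE OWNER's `hS_hSall_of_rows` AT INDEPENDENT PER-ROW SCALARS** (`d = 3`, `2 ≤ Lc`): each of the twelve rows is supplied at its own
rate∕ratio(s); the merge §1 aligns them; the owner's END closes. -/
theorem hS_hSall_of_rows_indep (hLc : 2 ≤ Lc) (cE cVH cΛ : ℝ)
    (hW : ∃ CW δ : ℝ, 0 < δ ∧ ∀ n : ℕ, LocStencil (fun κ' u' x' z' a b => ((Lc : ℝ) ^ (n + 1 + 1)) ^ (2 * (3 + 1)) *
      e3OfS (Lc ^ (n + 1 + 1)) (fun κ u => (cE * ((Lc : ℝ) ^ (3 + 1)) ^ (n + 1)) • wilsonA 3 κ u) κ' u' x' z' a b) CW δ)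
    (hV0 : ∃ c₀V θ δ : ℝ, 0 < δ ∧ 0 ≤ θ ∧ θ < 1 ∧ ∀ n : ℕ, LocStencil (fun κ' u' x' z' a b => ((Lc : ℝ) ^ (n + 1 + 1)) ^ (2 * (3 + 1)) *
      e3OfS (Lc ^ (n + 1 + 1)) (fun κ u => (((Lc : ℝ) ^ (3 + 1)) ^ (n + 1) * cVH) • pushSum Lc (Lc ^ (n + 1)) (mfNeg (vhS 3 Lc κ u)))
        κ' u' x' z' a b) (c₀V * θ ^ (n + 1)) δ)
    (hL0 : ∃ c₀L θ δ : ℝ, 0 < δ ∧ 0 ≤ θ ∧ θ < 1 ∧ ∀ n : ℕ, LocStencil (fun κ' u' x' z' a b => ((Lc : ℝ) ^ (n + 1 + 1)) ^ (2 * (3 + 1)) *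
      e3OfS (Lc ^ (n + 1 + 1)) (fun κ u => (((Lc : ℝ) ^ (3 + 1)) ^ (n + 1) * cΛ) •
        SLam Lc (lamCoeffOf (KInv (N := Lc) (d := 3)) Lc) (fun μ y => hessFF Lc μ y) κ u) κ' u' x' z' a b) (c₀L * θ ^ (n + 1)) δ)
    (hVt : ∃ CtV δ : ℝ, 0 < δ ∧ ∀ n : ℕ, LocStencil (fun κ' u' x' z' a b => ((Lc : ℝ) ^ (n + 1 + 1)) ^ (2 * (3 + 1)) *
      e3OfS (Lc ^ (n + 1 + 1)) (fun κ u => (cVH * ((Lc : ℝ) ^ (n + 1)) ^ (3 + 2)) • borderInc 3 Lc (Lc ^ (n + 1)) κ u)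
        κ' u' x' z' a b) CtV δ)
    (hLt : ∃ CtL δ : ℝ, 0 < δ ∧ ∀ n : ℕ, LocStencil (fun κ' u' x' z' a b => ((Lc : ℝ) ^ (n + 1 + 1)) ^ (2 * (3 + 1)) *
      e3OfS (Lc ^ (n + 1 + 1)) (fun κ u => (cΛ * ((Lc : ℝ) ^ (n + 1)) ^ (2 * 3 + 4)) •
        lagrInc 3 Lc (Lc ^ (n + 1)) (Lc ^ (n + 1 + 1)) κ u) κ' u' x' z' a b) CtL δ)
    (hV : ∃ cV θ δ : ℝ, 0 < δ ∧ 0 ≤ θ ∧ θ < 1 ∧ ∀ n m : ℕ, m < n → LocStencil (fun κ' u' x' z' a b => ((Lc : ℝ) ^ (n + 1 + 1)) ^ (2 * (3 + 1)) *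
      e3OfS (Lc ^ (n + 1 + 1)) (fun κ u => (((Lc : ℝ) ^ (3 + 1)) ^ (n - m) * (cVH * ((Lc : ℝ) ^ (m + 1)) ^ (3 + 2))) •
        pushSum (Lc ^ (m + 1 + 1)) (Lc ^ (n - m)) (borderInc 3 Lc (Lc ^ (m + 1)) κ u)) κ' u' x' z' a b) (cV * θ ^ (n - m)) δ)
    (hL : ∃ cL θ δ : ℝ, 0 < δ ∧ 0 ≤ θ ∧ θ < 1 ∧ ∀ n m : ℕ, m < n → LocStencil (fun κ' u' x' z' a b => ((Lc : ℝ) ^ (n + 1 + 1)) ^ (2 * (3 + 1)) *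
      e3OfS (Lc ^ (n + 1 + 1)) (fun κ u => (((Lc : ℝ) ^ (3 + 1)) ^ (n - m) * (cΛ * ((Lc : ℝ) ^ (m + 1)) ^ (2 * 3 + 4))) •
        lagrInc 3 Lc (Lc ^ (m + 1)) (Lc ^ (m + 1 + 1)) κ u) κ' u' x' z' a b) (cL * θ ^ (n - m)) δ)
    (dW : ∃ eW θ : ℝ, 0 ≤ θ ∧ θ < 1 ∧ ∀ (n : ℕ) (κ' : Fin (3 + 1)) (u' : Fin (3 + 1) → ℤ), SupBound (fun x z a b =>
      ((Lc : ℝ) ^ (n + 1 + 1 + 1)) ^ (2 * (3 + 1)) * e3OfS (Lc ^ (n + 1 + 1 + 1)) (fun κ u => (cE * ((Lc : ℝ) ^ (3 + 1)) ^ (n + 1 + 1)) • wilsonA 3 κ u) κ' u' x z a b -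
      ((Lc : ℝ) ^ (n + 1 + 1)) ^ (2 * (3 + 1)) * e3OfS (Lc ^ (n + 1 + 1)) (fun κ u => (cE * ((Lc : ℝ) ^ (3 + 1)) ^ (n + 1)) • wilsonA 3 κ u) κ' u' x z a b) (eW * θ ^ (n + 1)))
    (dVt : ∃ eVt θ : ℝ, 0 ≤ θ ∧ θ < 1 ∧ ∀ (n : ℕ) (κ' : Fin (3 + 1)) (u' : Fin (3 + 1) → ℤ), SupBound (fun x z a b =>
      ((Lc : ℝ) ^ (n + 1 + 1 + 1)) ^ (2 * (3 + 1)) * e3OfS (Lc ^ (n + 1 + 1 + 1)) (fun κ u => (cVH * ((Lc : ℝ) ^ (n + 1 + 1)) ^ (3 + 2)) • borderInc 3 Lc (Lc ^ (n + 1 + 1)) κ u) κ' u' x z a b -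
      ((Lc : ℝ) ^ (n + 1 + 1)) ^ (2 * (3 + 1)) * e3OfS (Lc ^ (n + 1 + 1)) (fun κ u => (cVH * ((Lc : ℝ) ^ (n + 1)) ^ (3 + 2)) • borderInc 3 Lc (Lc ^ (n + 1)) κ u) κ' u' x z a b) (eVt * θ ^ (n + 1)))
    (dLt : ∃ eLt θ : ℝ, 0 ≤ θ ∧ θ < 1 ∧ ∀ (n : ℕ) (κ' : Fin (3 + 1)) (u' : Fin (3 + 1) → ℤ), SupBound (fun x z a b =>
      ((Lc : ℝ) ^ (n + 1 + 1 + 1)) ^ (2 * (3 + 1)) * e3OfS (Lc ^ (n + 1 + 1 + 1)) (fun κ u => (cΛ * ((Lc : ℝ) ^ (n + 1 + 1)) ^ (2 * 3 + 4)) •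
        lagrInc 3 Lc (Lc ^ (n + 1 + 1)) (Lc ^ (n + 1 + 1 + 1)) κ u) κ' u' x z a b -
      ((Lc : ℝ) ^ (n + 1 + 1)) ^ (2 * (3 + 1)) * e3OfS (Lc ^ (n + 1 + 1)) (fun κ u => (cΛ * ((Lc : ℝ) ^ (n + 1)) ^ (2 * 3 + 4)) •
        lagrInc 3 Lc (Lc ^ (n + 1)) (Lc ^ (n + 1 + 1)) κ u) κ' u' x z a b) (eLt * θ ^ (n + 1)))
    (dV : ∃ eV θ ρ : ℝ, 0 ≤ θ ∧ θ < 1 ∧ 0 ≤ ρ ∧ ρ < 1 ∧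
      ∀ (n m : ℕ), m < n → ∀ (κ' : Fin (3 + 1)) (u' : Fin (3 + 1) → ℤ), SupBound (fun x z a b =>
      ((Lc : ℝ) ^ (n + 1 + 1 + 1)) ^ (2 * (3 + 1)) * e3OfS (Lc ^ (n + 1 + 1 + 1)) (fun κ u => ((((Lc : ℝ) ^ (3 + 1)) ^ (n - m) * (cVH * ((Lc : ℝ) ^ (m + 1 + 1)) ^ (3 + 2))) •
        pushSum (Lc ^ (m + 1 + 1 + 1)) (Lc ^ (n - m)) (borderInc 3 Lc (Lc ^ (m + 1 + 1)) κ u))) κ' u' x z a b -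
      ((Lc : ℝ) ^ (n + 1 + 1)) ^ (2 * (3 + 1)) * e3OfS (Lc ^ (n + 1 + 1)) (fun κ u => ((((Lc : ℝ) ^ (3 + 1)) ^ (n - m) * (cVH * ((Lc : ℝ) ^ (m + 1)) ^ (3 + 2))) •
        pushSum (Lc ^ (m + 1 + 1)) (Lc ^ (n - m)) (borderInc 3 Lc (Lc ^ (m + 1)) κ u))) κ' u' x z a b) (eV * θ ^ (n + 1) * ρ ^ (n - m)))
    (dL : ∃ eL θ ρ : ℝ, 0 ≤ θ ∧ θ < 1 ∧ 0 ≤ ρ ∧ ρ < 1 ∧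
      ∀ (n m : ℕ), m < n → ∀ (κ' : Fin (3 + 1)) (u' : Fin (3 + 1) → ℤ), SupBound (fun x z a b =>
      ((Lc : ℝ) ^ (n + 1 + 1 + 1)) ^ (2 * (3 + 1)) * e3OfS (Lc ^ (n + 1 + 1 + 1)) (fun κ u => ((((Lc : ℝ) ^ (3 + 1)) ^ (n - m) * (cΛ * ((Lc : ℝ) ^ (m + 1 + 1)) ^ (2 * 3 + 4))) •
        lagrInc 3 Lc (Lc ^ (m + 1 + 1)) (Lc ^ (m + 1 + 1 + 1)) κ u)) κ' u' x z a b -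
      ((Lc : ℝ) ^ (n + 1 + 1)) ^ (2 * (3 + 1)) * e3OfS (Lc ^ (n + 1 + 1)) (fun κ u => ((((Lc : ℝ) ^ (3 + 1)) ^ (n - m) * (cΛ * ((Lc : ℝ) ^ (m + 1)) ^ (2 * 3 + 4))) •
        lagrInc 3 Lc (Lc ^ (m + 1)) (Lc ^ (m + 1 + 1)) κ u)) κ' u' x z a b) (eL * θ ^ (n + 1) * ρ ^ (n - m)))
        (W : ℕ → Fin (3 + 1) → (Fin (3 + 1) → ℤ) → Fin (3 + 1) → (Fin (3 + 1) → ℤ) → MKer (3 + 1) (Fib 3))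
    (Cw δw : ℕ → ℝ) (hδw : ∀ j, 0 < δw j) (hW' : ∀ j, VertexFamily₂ (W j) Lc (Cw j) (δw j)) :
        ∃ Cs cS θS δS : ℝ, 0 ≤ θS ∧ θS < 1 ∧ 0 < δS ∧
      (∀ j, LocStencil (unitS (sfStep Lc j) (smStep 3 Lc j) (JsBal0Of (one_le_of_two_le hLc) cE cVH cΛ W Cw δw hδw hW' j).S) Cs δS) ∧
      (∀ k j, LocStencil (unitS (sfStep Lc (k + j)) (smStep 3 Lc (k + j))
          (JsBal0Of (one_le_of_two_le hLc) cE cVH cΛ W Cw δw hδw hW' (k + j)).S -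
        unitS (sfStep Lc k) (smStep 3 Lc k) (JsBal0Of (one_le_of_two_le hLc) cE cVH cΛ W Cw δw hδw hW' k).S) (cS * θS ^ k) δS) := by
  obtain ⟨δ, θ, ρ, CW, c₀V, c₀L, CtV, CtL, cV, cL, eW, eVt, eLt, eV, eL, hδ, hθ0, hθ1, hρ0, hρ1,
      h₁, h₂, h₃, h₄, h₅, h₆, h₇, h₈, h₉, h₁₀, h₁₁, h₁₂⟩ :=
    rows_merge (d := 3) hW hV0 hL0 hVt hLt hV hL dW dVt dLt dV dL
  exact hS_hSall_of_rows hLc cE cVH cΛ hδ hθ0 hθ1 hρ0 hρ1 h₁ h₂ h₃ h₄ h₅ h₆ h₇ h₈ h₉ h₁₀ h₁₁ h₁₂ W Cw δw hδw hW'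

/-! ## §3 The wall's `hS` from the seven SHAPE rows alone (`d = 3`, `2 ≤ Lc`; row owner) -/

/-- **THE WALL's NON-CAUCHY S-ROW `hS` FROM THE SEVEN SHAPE ROWS ALONE, EACH AT ITS OWN SCALARS** (`d = 3`, `2 ≤ Lc`): the seven SHAPE rows
of road «S3» (texts verbatim from `StencilSlotE3OfPieces.e3Shape_of_pieces` at `d = 3`, ∃-packaged per row) give «E3Shape» by
`shapeRows_merge` ∘ `e3Shape_of_pieces`, and «E3Shape» alone gives the wall's `hS` for the Bałaban jets `JsBal0Of` by `StencilSlotOfE3.hS_of_e3`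
(K-slot inside).  The five DIFFERENCE rows are NOT needed for this half. [folklore] composition. -/
theorem hS_of_shapeRows_indep (hLc : 2 ≤ Lc) (cE cVH cΛ : ℝ)
    (hW : ∃ CW δ : ℝ, 0 < δ ∧ ∀ n : ℕ, LocStencil (fun κ' u' x' z' a b => ((Lc : ℝ) ^ (n + 1 + 1)) ^ (2 * (3 + 1)) *
      e3OfS (Lc ^ (n + 1 + 1)) (fun κ u => (cE * ((Lc : ℝ) ^ (3 + 1)) ^ (n + 1)) • wilsonA 3 κ u) κ' u' x' z' a b) CW δ)
    (hV0 : ∃ c₀V θ δ : ℝ, 0 < δ ∧ 0 ≤ θ ∧ θ < 1 ∧ ∀ n : ℕ, LocStencil (fun κ' u' x' z' a b => ((Lc : ℝ) ^ (n + 1 + 1)) ^ (2 * (3 + 1)) *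
      e3OfS (Lc ^ (n + 1 + 1)) (fun κ u => (((Lc : ℝ) ^ (3 + 1)) ^ (n + 1) * cVH) • pushSum Lc (Lc ^ (n + 1)) (mfNeg (vhS 3 Lc κ u)))
        κ' u' x' z' a b) (c₀V * θ ^ (n + 1)) δ)
    (hL0 : ∃ c₀L θ δ : ℝ, 0 < δ ∧ 0 ≤ θ ∧ θ < 1 ∧ ∀ n : ℕ, LocStencil (fun κ' u' x' z' a b => ((Lc : ℝ) ^ (n + 1 + 1)) ^ (2 * (3 + 1)) *
      e3OfS (Lc ^ (n + 1 + 1)) (fun κ u => (((Lc : ℝ) ^ (3 + 1)) ^ (n + 1) * cΛ) •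
        SLam Lc (lamCoeffOf (KInv (N := Lc) (d := 3)) Lc) (fun μ y => hessFF Lc μ y) κ u) κ' u' x' z' a b) (c₀L * θ ^ (n + 1)) δ)
    (hVt : ∃ CtV δ : ℝ, 0 < δ ∧ ∀ n : ℕ, LocStencil (fun κ' u' x' z' a b => ((Lc : ℝ) ^ (n + 1 + 1)) ^ (2 * (3 + 1)) *
      e3OfS (Lc ^ (n + 1 + 1)) (fun κ u => (cVH * ((Lc : ℝ) ^ (n + 1)) ^ (3 + 2)) • borderInc 3 Lc (Lc ^ (n + 1)) κ u)
        κ' u' x' z' a b) CtV δ)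
    (hLt : ∃ CtL δ : ℝ, 0 < δ ∧ ∀ n : ℕ, LocStencil (fun κ' u' x' z' a b => ((Lc : ℝ) ^ (n + 1 + 1)) ^ (2 * (3 + 1)) *
      e3OfS (Lc ^ (n + 1 + 1)) (fun κ u => (cΛ * ((Lc : ℝ) ^ (n + 1)) ^ (2 * 3 + 4)) •
        lagrInc 3 Lc (Lc ^ (n + 1)) (Lc ^ (n + 1 + 1)) κ u) κ' u' x' z' a b) CtL δ)
    (hV : ∃ cV θ δ : ℝ, 0 < δ ∧ 0 ≤ θ ∧ θ < 1 ∧ ∀ n m : ℕ, m < n → LocStencil (fun κ' u' x' z' a b => ((Lc : ℝ) ^ (n + 1 + 1)) ^ (2 * (3 + 1)) *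
      e3OfS (Lc ^ (n + 1 + 1)) (fun κ u => (((Lc : ℝ) ^ (3 + 1)) ^ (n - m) * (cVH * ((Lc : ℝ) ^ (m + 1)) ^ (3 + 2))) •
        pushSum (Lc ^ (m + 1 + 1)) (Lc ^ (n - m)) (borderInc 3 Lc (Lc ^ (m + 1)) κ u)) κ' u' x' z' a b) (cV * θ ^ (n - m)) δ)
    (hL : ∃ cL θ δ : ℝ, 0 < δ ∧ 0 ≤ θ ∧ θ < 1 ∧ ∀ n m : ℕ, m < n → LocStencil (fun κ' u' x' z' a b => ((Lc : ℝ) ^ (n + 1 + 1)) ^ (2 * (3 + 1)) *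
      e3OfS (Lc ^ (n + 1 + 1)) (fun κ u => (((Lc : ℝ) ^ (3 + 1)) ^ (n - m) * (cΛ * ((Lc : ℝ) ^ (m + 1)) ^ (2 * 3 + 4))) •
        lagrInc 3 Lc (Lc ^ (m + 1)) (Lc ^ (m + 1 + 1)) κ u) κ' u' x' z' a b) (cL * θ ^ (n - m)) δ)
    (W : ℕ → Fin (3 + 1) → (Fin (3 + 1) → ℤ) → Fin (3 + 1) → (Fin (3 + 1) → ℤ) → MKer (3 + 1) (Fib 3))
    (Cw δw : ℕ → ℝ) (hδw : ∀ j, 0 < δw j) (hW' : ∀ j, VertexFamily₂ (W j) Lc (Cw j) (δw j)) :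
    ∃ Cs δS : ℝ, 0 < δS ∧ ∀ j, LocStencil (unitS (sfStep Lc j) (smStep 3 Lc j)
      (JsBal0Of (one_le_of_two_le hLc) cE cVH cΛ W Cw δw hδw hW' j).S) Cs δS := by
  obtain ⟨δ, θ, CW, c₀V, c₀L, CtV, CtL, cV, cL, hδ, hθ0, hθ1, h₁, h₂, h₃, h₄, h₅, h₆, h₇⟩ :=
    shapeRows_merge (d := 3) hW hV0 hL0 hVt hLt hV hL
  obtain ⟨C₃, δ₃, hδ₃, hE3⟩ := e3Shape_of_pieces (d := 3) (one_le_of_two_le hLc) cE cVH cΛ hδ hθ0 hθ1 h₁ h₂ h₃ h₄ h₅ h₆ h₇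
  exact hS_of_e3 hLc hE3 hδ₃ W Cw δw hδw hW'

end Three

end Summit.QuantumFields.BalabanUV.Beta.GAN24.StencilSlotRowsMerge

end
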